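import Literature.NumberTheory.Sieve.GoldbachLinnikMeanSquare
import Literature.NumberTheory.Sieve.VinogradovExpSum
import Literature.NumberTheory.Sieve.MontgomeryVaughan1975MinorArcs
import HarnessLib

/-!
# Goldbach–Linnik numbers: the minor-arc bound for `S(α) = ∑_{p ≤ N} e(pα)` (Pintz–Ruzsa I, (2.10))

Topic `Literature/NumberTheory/Sieve`; support file for the named fact
`Literature.NumberTheory.Sieve.goldbach_linnik` (parity.S36). Sequel to
`GoldbachLinnikMeanSquare.lean`: it discharges, unconditionally and for the tree's Vaughan-style
arcs `Literature.NumberTheory.Sieve.majorArcs N P Q`, the minor-arc input `hS` of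
`GoldbachLinnik.goldbach_linnik_of_analytic_inputs` — the analogue of Pintz–Ruzsa I, Lemma 2
((2.9)–(2.10), there under GRH with `S(α) ≪ (N/√P + √(NQ) + N/√Q) L²`), here from Vinogradov's
theorem as proved in the tree (`Literature.NumberTheory.Sieve.Vinogradov.vinogradov_primeExpSumLog_bound`,
Nathanson GTM 164 Thm 8.5: `|∑_{p ≤ N} (log p) e(pα)| ≤ C(N/√q + N^{4/5} + √N√q) log⁴N` for
`(a,q) = 1`, `q ≤ N`, `|α - a/q| ≤ q⁻²`):

* `norm_primeSum_le_of_logSum_le` — partial summation (Abel's lemma, weights `1/log n`): a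
  uniform bound `B` for the odd-prime log-weighted sums up to `n ≤ N` bounds `|S(α)| ≤ B`;
* `norm_primeSum_vinogradov` — hence `|S(α)| ≤ C'(N/√q + N^{4/5} + √N√q) log⁴N` for the
  UNWEIGHTED sum over odd primes (`N ≥ 3`), with an absolute `C'`;
* `norm_primeSum_le_of_mem_minorArcs` — by Dirichlet's theorem, for `1 ≤ P ≤ N`, `1 ≤ Q` and
  `α ∈ 𝔪 = [0,1] ∖ 𝔐(N; P, Q)`: `|S(α)| ≤ C'(N/√Q + N^{4/5} + N/√P) log⁴ N`;
* `norm_primeSum_le_of_mem_minorArcsMV`, `norm_primeSum_le_of_not_mem_periodic_majorArcs` — the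
  same for Pintz–Ruzsa's own arcs (2.2)–(2.3), of `q`-dependent width: `𝔐 = ⋃_{q ≤ P} ⋃_{(a,q)=1}
  [a/q - 1/(qQ), a/q + 1/(qQ)]` on `[1/Q, 1 + 1/Q]` (the tree's
  `MontgomeryVaughan1975.majorArcs P Q` / `minorArcs P Q`, with its Dirichlet lemma
  `MontgomeryVaughan1975.exists_rat_of_mem_minorArcs`): for `1 ≤ P`, `P + 1 ≤ Q ≤ N`,
  `|S(α)| ≤ C'(N/√P + N^{4/5} + √N√Q) log⁴ N` on the minor arcs, and — by `1`-periodicity of `S`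
  (`primeSum_add_one`) — on `[0,1]` off the periodised arcs `𝔐 ∪ (𝔐 - 1)`. (With `P = N^{2/5}`,
  `Q = N^{3/5}` this is `≪ N^{4/5} log⁴ N`, the level forced on Part II by Vinogradov's theorem;
  the uniform-width arcs `𝔐(N; P, Q)` cannot reach it with arcs of measure `< 1`.)

No named facts and no definitions are introduced (the log-weighted odd-prime sum
`GoldbachLinnik.oddPrimeLogSum` is defined in `GoldbachLinnikMeanSquareSplit.lean`).

## References

* J. Pintz, I. Z. Ruzsa, *On Linnik's approximation to Goldbach's problem, I*, Acta Arith. 109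
  (2003) 169–194, Lemma 2, (2.9)–(2.10). [PintzRuzsa2003]
* M. B. Nathanson, *Additive Number Theory: The Classical Bases*, GTM 164 (1996), Thm 8.5.
  [Nathanson1996]
* R. C. Vaughan, *The Hardy–Littlewood Method*, 2nd ed. (1997), §3.1 (arcs), Lemma 2.1
  (Dirichlet). [VaughanHL1997]
-/

noncomputable section

open scoped FourierTransform Chebyshev

open Finset Filter

namespace Literature.NumberTheory.Sieve

namespace GoldbachLinnik

/-! ### The log-weighted sum over odd primes (`GoldbachLinnik.oddPrimeLogSum`) -/

/-- `oddPrimes n` is the set of odd members of `Nat.primesLE n`. [folklore] -/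
theorem oddPrimes_eq_filter (n : ℕ) : oddPrimes n = (Nat.primesLE n).filter Odd := by
  ext p
  simp only [oddPrimes, mem_filter, mem_range, Nat.mem_primesLE, Nat.lt_succ_iff, and_assoc]

/-- `|A(n)| ≤ |∑_{p ≤ n} (log p) e(pα)| + log 2` (only the prime `2` is removed). [folklore] -/
theorem norm_oddPrimeLogSum_le (n : ℕ) (α : ℝ) :
    ‖oddPrimeLogSum n α‖ ≤ ‖primeExpSumLog n α‖ + Real.log 2 := by
  have hsplit := Finset.sum_filter_add_sum_filter_not (Nat.primesLE n) Odd
    (fun p => (Real.log p : ℂ) * (𝐞 ((p : ℝ) * α) : ℂ))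
  have hodd : ∑ p ∈ (Nat.primesLE n).filter Odd, (Real.log p : ℂ) * (𝐞 ((p : ℝ) * α) : ℂ) =
      oddPrimeLogSum n α := by rw [oddPrimeLogSum, oddPrimes_eq_filter]
  have hR : ‖∑ p ∈ (Nat.primesLE n).filter (fun p => ¬ Odd p),
      (Real.log p : ℂ) * (𝐞 ((p : ℝ) * α) : ℂ)‖ ≤ Real.log 2 := by
    refine (norm_sum_le _ _).trans ?_
    have hsub : (Nat.primesLE n).filter (fun p => ¬ Odd p) ⊆ {2} := by
      intro p hp
      rw [mem_filter, Nat.mem_primesLE] at hp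
      rw [mem_singleton]
      rcases hp.1.2.eq_two_or_odd' with h | h
      · exact h
      · exact absurd h hp.2
    calc ∑ p ∈ (Nat.primesLE n).filter (fun p => ¬ Odd p), ‖(Real.log p : ℂ) * (𝐞 ((p : ℝ) * α) : ℂ)‖
        ≤ ∑ p ∈ ({2} : Finset ℕ), ‖(Real.log p : ℂ) * (𝐞 ((p : ℝ) * α) : ℂ)‖ :=
          Finset.sum_le_sum_of_subset_of_nonneg hsub fun _ _ _ => norm_nonneg _
      _ = Real.log 2 := by
          rw [sum_singleton, norm_mul, Circle.norm_coe, mul_one, Complex.norm_real,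
            Real.norm_of_nonneg (Real.log_nonneg (by norm_num))]
          norm_num
  have heq : oddPrimeLogSum n α = primeExpSumLog n α -
      ∑ p ∈ (Nat.primesLE n).filter (fun p => ¬ Odd p), (Real.log p : ℂ) * (𝐞 ((p : ℝ) * α) : ℂ) := by
    rw [← hodd, primeExpSumLog, ← hsplit]; ring
  rw [heq]
  exact (norm_sub_le _ _).trans (add_le_add le_rfl hR)

/-- The trivial bound `|A(n)| ≤ θ(n)`. [folklore] -/
theorem norm_oddPrimeLogSum_le_theta (n : ℕ) (α : ℝ) : ‖oddPrimeLogSum n α‖ ≤ θ n := by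
  rw [Chebyshev.theta_eq_sum_primesLE_log, oddPrimeLogSum, oddPrimes_eq_filter]
  refine (norm_sum_le _ _).trans ?_
  calc ∑ p ∈ (Nat.primesLE n).filter Odd, ‖(Real.log p : ℂ) * (𝐞 ((p : ℝ) * α) : ℂ)‖
      = ∑ p ∈ (Nat.primesLE n).filter Odd, Real.log p := by
        refine Finset.sum_congr rfl fun p hp => ?_
        rw [mem_filter, Nat.mem_primesLE] at hp
        rw [norm_mul, Circle.norm_coe, mul_one, Complex.norm_real,
          Real.norm_of_nonneg (Real.log_nonneg (by exact_mod_cast hp.1.2.one_le))]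
    _ ≤ ∑ p ∈ Nat.primesLE n, Real.log p :=
        Finset.sum_le_sum_of_subset_of_nonneg (filter_subset _ _) fun p hp _ =>
          Real.log_nonneg (by exact_mod_cast (Nat.mem_primesLE.1 hp).2.one_le)

/-- `A(2) = 0` (there are no odd primes `≤ 2`). [folklore] -/
theorem oddPrimeLogSum_two (α : ℝ) : oddPrimeLogSum 2 α = 0 := by
  refine Finset.sum_eq_zero fun p hp => ?_
  exfalso
  obtain ⟨hp2, hpr, hodd⟩ := mem_oddPrimes.1 hp
  interval_cases p
  · exact Nat.not_prime_zero hpr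
  · exact Nat.not_prime_one hpr
  · exact (Nat.not_even_iff_odd.2 hodd) even_two

/-! ### Partial summation -/

/-- The telescoping sum of the weights `1/log n`. [folklore] -/
theorem sum_Ioc_inv_log_sub (M : ℕ) (hM : 2 ≤ M) :
    ∑ i ∈ Ioc 2 M, (1 / Real.log i - 1 / Real.log (i + 1)) =
      1 / Real.log 3 - 1 / Real.log (M + 1) := by
  induction M, hM using Nat.le_induction with
  | base => norm_num [Finset.Ioc_self]
  | succ m hm ih =>
    rw [Finset.sum_Ioc_succ_top (by omega), ih]
    push_cast
    ring

/-- **Partial summation** (Abel's lemma with the decreasing weights `1/log n`): if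
`|∑_{p ≤ n, p odd} (log p) e(pα)| ≤ B` for all `3 ≤ n ≤ N`, then `|∑_{p ≤ N, p odd} e(pα)| ≤ B`
(the exact bound is `B / log 3`). [cite: VaughanHL1997, §3.1 (partial summation)] -/
theorem norm_primeSum_le_of_logSum_le {N : ℕ} (hN : 3 ≤ N) {α B : ℝ}
    (hB : ∀ n : ℕ, 3 ≤ n → n ≤ N → ‖oddPrimeLogSum n α‖ ≤ B) : ‖primeSum N α‖ ≤ B := by
  classical
  set f : ℕ → ℝ := fun i => 1 / Real.log i with hf
  set g : ℕ → ℂ := fun i => if i.Prime ∧ Odd i then (Real.log i : ℂ) * (𝐞 ((i : ℝ) * α) : ℂ) else 0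
    with hg
  have hB0 : 0 ≤ B := (norm_nonneg _).trans (hB N hN le_rfl)
  -- partial sums of `g`
  have hG : ∀ k : ℕ, ∑ i ∈ range (k + 1), g i = oddPrimeLogSum k α := by
    intro k
    rw [oddPrimeLogSum, oddPrimes, Finset.sum_filter]
  -- the weighted sum is `S(α)`
  have hS : ∑ i ∈ Ioc 2 N, f i • g i = primeSum N α := by
    have h1 : ∑ i ∈ Ioc 2 N, f i • g i =
        ∑ i ∈ Ioc 2 N, if i.Prime ∧ Odd i then (𝐞 ((i : ℝ) * α) : ℂ) else 0 := by
      refine Finset.sum_congr rfl fun i hi => ?_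
      simp only [hg, hf]
      split_ifs with h
      · have hi3 : (3 : ℝ) ≤ i := by
          have := h.1.two_le
          have h2 : i ≠ 2 := fun h2 => by rw [h2] at h; exact (Nat.not_even_iff_odd.2 h.2) even_two
          exact_mod_cast (show 3 ≤ i by omega)
        have hlog : Real.log i ≠ 0 := (Real.log_pos (by linarith)).ne'
        rw [Complex.real_smul, ← mul_assoc, ← Complex.ofReal_mul,
          show 1 / Real.log i * Real.log i = 1 by field_simp, Complex.ofReal_one, one_mul]
      · rw [smul_zero]
    rw [h1, ← Finset.sum_filter, primeSum]
    refine Finset.sum_congr ?_ fun _ _ => rfl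
    ext p
    simp only [mem_filter, mem_Ioc, oddPrimes, mem_range, Nat.lt_succ_iff]
    constructor
    · rintro ⟨⟨-, hpN⟩, hp⟩; exact ⟨hpN, hp⟩
    · rintro ⟨hpN, hp⟩
      have := hp.1.two_le
      have h2 : p ≠ 2 := fun h2 => by rw [h2] at hp; exact (Nat.not_even_iff_odd.2 hp.2) even_two
      exact ⟨⟨by omega, hpN⟩, hp⟩
  -- Abel summation
  have hAbel := Finset.sum_Ioc_by_parts f g (show 2 < N by omega)
  rw [hS, hG, hG, oddPrimeLogSum_two, smul_zero, sub_zero] at hAbel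
  simp_rw [hG] at hAbel
  -- monotonicity of the weights
  have hfmono : ∀ i : ℕ, 3 ≤ i → f (i + 1) ≤ f i := by
    intro i hi
    simp only [hf]
    have hi' : (3 : ℝ) ≤ i := by exact_mod_cast hi
    exact one_div_le_one_div_of_le (Real.log_pos (by linarith))
      (Real.log_le_log (by linarith) (by push_cast; linarith))
  have hfpos : ∀ i : ℕ, 3 ≤ i → 0 < f i := fun i hi => by
    simp only [hf]
    have hi' : (3 : ℝ) ≤ i := by exact_mod_cast hi
    exact one_div_pos.2 (Real.log_pos (by linarith))
  -- estimate
  rw [hAbel]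
  have hterm1 : ‖f N • oddPrimeLogSum N α‖ ≤ f N * B := by
    rw [norm_smul, Real.norm_of_nonneg (hfpos N hN).le]
    exact mul_le_mul_of_nonneg_left (hB N hN le_rfl) (hfpos N hN).le
  have hterm2 : ‖∑ i ∈ Ioc 2 (N - 1), (f (i + 1) - f i) • oddPrimeLogSum i α‖ ≤
      (1 / Real.log 3 - f N) * B := by
    refine (norm_sum_le _ _).trans ?_
    calc ∑ i ∈ Ioc 2 (N - 1), ‖(f (i + 1) - f i) • oddPrimeLogSum i α‖
        ≤ ∑ i ∈ Ioc 2 (N - 1), (f i - f (i + 1)) * B := by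
          refine Finset.sum_le_sum fun i hi => ?_
          rw [mem_Ioc] at hi
          rw [norm_smul, Real.norm_eq_abs, abs_sub_comm, abs_of_nonneg (by linarith [hfmono i hi.1])]
          exact mul_le_mul_of_nonneg_left (hB i hi.1 (by omega)) (by linarith [hfmono i hi.1])
      _ = (1 / Real.log 3 - f N) * B := by
          rw [← Finset.sum_mul]
          congr 1
          simp only [hf]
          push_cast
          rw [sum_Ioc_inv_log_sub (N - 1) (by omega), Nat.cast_sub (by omega)]
          push_cast
          ring
  have hlog3 : 1 / Real.log 3 ≤ 1 := by
    rw [div_le_one (Real.log_pos (by norm_num))]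
    have he : Real.exp 1 ≤ 3 := by have := Real.exp_one_lt_d9; linarith
    simpa using Real.log_le_log (Real.exp_pos 1) he
  calc ‖f N • oddPrimeLogSum N α - ∑ i ∈ Ioc 2 (N - 1), (f (i + 1) - f i) • oddPrimeLogSum i α‖
      ≤ f N * B + (1 / Real.log 3 - f N) * B := (norm_sub_le _ _).trans (add_le_add hterm1 hterm2)
    _ = 1 / Real.log 3 * B := by ring
    _ ≤ 1 * B := mul_le_mul_of_nonneg_right hlog3 hB0
    _ = B := one_mul B

/-! ### Vinogradov's bound for the unweighted sum -/

/-- **Vinogradov's estimate for `S(α) = ∑_{p ≤ N, p odd} e(pα)`**: there is an absolute `C` such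
that for `N ≥ 3`, `1 ≤ q ≤ N`, `(a,q) = 1`, `|α - a/q| ≤ q⁻²`,
`|S(α)| ≤ C (N/√q + N^{4/5} + √N√q) log⁴ N` (from the tree's log-weighted theorem by partial
summation; the primes `p < q` are estimated trivially by `θ(n) ≤ n log 4`).
[cite: Nathanson1996, Theorem 8.5 (unweighted form by partial summation)] -/
theorem norm_primeSum_vinogradov :
    ∃ C : ℝ, 0 ≤ C ∧ ∀ N : ℕ, 3 ≤ N → ∀ (α : ℝ) (a : ℤ) (q : ℕ), 1 ≤ q → q ≤ N →
      IsCoprime a (q : ℤ) → |α - a / q| ≤ 1 / (q : ℝ) ^ 2 →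
        ‖primeSum N α‖ ≤
          C * ((N : ℝ) / Real.sqrt q + (N : ℝ) ^ (4 / 5 : ℝ) + Real.sqrt N * Real.sqrt q) *
            Real.log N ^ 4 := by
  obtain ⟨C₀, hV⟩ := Vinogradov.vinogradov_primeExpSumLog_bound
  set C₁ : ℝ := max C₀ 0 with hC₁
  have hC₁0 : 0 ≤ C₁ := le_max_right _ _
  refine ⟨C₁ + 2, by positivity, fun N hN α a q hq hqN hcop hα => ?_⟩
  have hN0 : (0 : ℝ) < N := by exact_mod_cast (show 0 < N by omega)
  have hN3 : (3 : ℝ) ≤ N := by exact_mod_cast hN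
  set X : ℝ := ((N : ℝ) / Real.sqrt q + (N : ℝ) ^ (4 / 5 : ℝ) + Real.sqrt N * Real.sqrt q) *
    Real.log N ^ 4 with hX
  have hlogN : 1 ≤ Real.log N := by
    have he : Real.exp 1 ≤ N := by have := Real.exp_one_lt_d9; linarith
    have := Real.log_le_log (Real.exp_pos 1) he
    rwa [Real.log_exp] at this
  have hlog4 : 1 ≤ Real.log N ^ 4 := one_le_pow₀ hlogN
  have hq0 : (0 : ℝ) < q := by exact_mod_cast hq
  have hsq : 0 < Real.sqrt q := Real.sqrt_pos.2 hq0
  have hP : 0 ≤ (N : ℝ) / Real.sqrt q := by positivity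
  have h45 : 1 ≤ (N : ℝ) ^ (4 / 5 : ℝ) := Real.one_le_rpow (by linarith) (by norm_num)
  have hR : (q : ℝ) ≤ Real.sqrt N * Real.sqrt q := by
    have hqN' : (q : ℝ) ≤ N := by exact_mod_cast hqN
    calc (q : ℝ) = Real.sqrt q * Real.sqrt q := (Real.mul_self_sqrt hq0.le).symm
      _ ≤ Real.sqrt N * Real.sqrt q :=
          mul_le_mul_of_nonneg_right (Real.sqrt_le_sqrt hqN') hsq.le
  have hXge : (N : ℝ) ^ (4 / 5 : ℝ) + Real.sqrt N * Real.sqrt q ≤ X := by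
    rw [hX]
    have h0 : 0 ≤ (N : ℝ) / Real.sqrt q + (N : ℝ) ^ (4 / 5 : ℝ) + Real.sqrt N * Real.sqrt q := by
      positivity
    nlinarith
  refine norm_primeSum_le_of_logSum_le hN fun n hn3 hnN => ?_
  rcases Nat.lt_or_ge n q with hnq | hnq
  · -- `n < q`: trivial bound `θ(n) ≤ n log 4 ≤ 2q ≤ 2 √N √q`
    have hθ := norm_oddPrimeLogSum_le_theta n α
    have h4 : θ n ≤ Real.log 4 * n := Chebyshev.theta_le_log4_mul_x (Nat.cast_nonneg n)
    have hl4 : Real.log 4 < 2 := by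
      rw [show (4 : ℝ) = 2 ^ 2 by norm_num, Real.log_pow]; have := Real.log_two_lt_d9
      push_cast; linarith
    have hnq' : (n : ℝ) ≤ q := by exact_mod_cast hnq.le
    calc ‖oddPrimeLogSum n α‖ ≤ Real.log 4 * n := hθ.trans h4
      _ ≤ 2 * (Real.sqrt N * Real.sqrt q) := by nlinarith [hR, Real.log_nonneg (by norm_num : (1:ℝ) ≤ 4)]
      _ ≤ 2 * X := by nlinarith [hXge, h45]
      _ ≤ (C₁ + 2) * X := by nlinarith [mul_nonneg hC₁0 (le_trans (by positivity) hXge)]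
      _ = _ := by rw [hX]; ring
  · -- `q ≤ n`: Vinogradov at `n`, then monotonicity in `n`
    have hn2 : 2 ≤ n := by omega
    have hVn := hV n hn2 α a q hq hnq hcop hα
    have hn0 : (0 : ℝ) < n := by exact_mod_cast (show 0 < n by omega)
    have hnN' : (n : ℝ) ≤ N := by exact_mod_cast hnN
    have hn1 : (1 : ℝ) ≤ n := by exact_mod_cast (show 1 ≤ n by omega)
    have hmono : (n : ℝ) / Real.sqrt q + (n : ℝ) ^ (4 / 5 : ℝ) + Real.sqrt n * Real.sqrt q ≤
        (N : ℝ) / Real.sqrt q + (N : ℝ) ^ (4 / 5 : ℝ) + Real.sqrt N * Real.sqrt q := by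
      gcongr
    have hlogn : Real.log n ^ 4 ≤ Real.log N ^ 4 :=
      pow_le_pow_left₀ (Real.log_nonneg hn1) (Real.log_le_log hn0 hnN') 4
    have hVn' : ‖primeExpSumLog n α‖ ≤ C₁ * X := by
      refine hVn.trans ?_
      have hb0 : 0 ≤ (n : ℝ) / Real.sqrt q + (n : ℝ) ^ (4 / 5 : ℝ) + Real.sqrt n * Real.sqrt q := by
        positivity
      calc C₀ * ((n : ℝ) / Real.sqrt q + (n : ℝ) ^ (4 / 5 : ℝ) + Real.sqrt n * Real.sqrt q) *
            Real.log n ^ 4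
          ≤ C₁ * ((n : ℝ) / Real.sqrt q + (n : ℝ) ^ (4 / 5 : ℝ) + Real.sqrt n * Real.sqrt q) *
            Real.log n ^ 4 :=
            mul_le_mul_of_nonneg_right (mul_le_mul_of_nonneg_right (le_max_left _ _) hb0)
              (pow_nonneg (Real.log_nonneg hn1) 4)
        _ ≤ C₁ * ((N : ℝ) / Real.sqrt q + (N : ℝ) ^ (4 / 5 : ℝ) + Real.sqrt N * Real.sqrt q) *
            Real.log N ^ 4 :=
            mul_le_mul (mul_le_mul_of_nonneg_left hmono hC₁0) hlogn
              (pow_nonneg (Real.log_nonneg hn1) 4) (mul_nonneg hC₁0 (by positivity))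
        _ = C₁ * X := by rw [hX]; ring
    calc ‖oddPrimeLogSum n α‖ ≤ ‖primeExpSumLog n α‖ + Real.log 2 := norm_oddPrimeLogSum_le n α
      _ ≤ C₁ * X + 2 * X := by
          have h2 : Real.log 2 ≤ 2 * X := by
            have := Real.log_two_lt_d9; nlinarith [hXge, h45, Real.sqrt_nonneg N, hsq]
          linarith
      _ = _ := by rw [hX]; ring

/-! ### The minor-arc bound -/

/-- **Minor-arc bound for `S(α)`** (Pintz–Ruzsa I (2.9)–(2.10), unconditional form via
Vinogradov): for `N ≥ 3`, `1 ≤ P ≤ N`, `1 ≤ Q` and `α ∈ 𝔪 = [0,1] ∖ 𝔐(N; P, Q)` (the tree's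
arcs: `|α - a/q| ≤ P/N` for some `q ≤ Q`), Dirichlet's theorem gives `(a,q) = 1`, `q ≤ N/P`,
`|α - a/q| ≤ 1/(q(⌊N/P⌋+1)) < P/N`, whence `q > Q`, and Vinogradov's estimate yields
`|S(α)| ≤ C (N/√Q + N^{4/5} + N/√P) log⁴N`. [cite: PintzRuzsa2003, Lemma 2 (2.9)–(2.10)] -/
theorem norm_primeSum_le_of_mem_minorArcs :
    ∃ C : ℝ, 0 ≤ C ∧ ∀ N : ℕ, 3 ≤ N → ∀ P Q : ℝ, 1 ≤ P → P ≤ N → 1 ≤ Q →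
      ∀ α ∈ minorArcs N P Q,
        ‖primeSum N α‖ ≤
          C * ((N : ℝ) / Real.sqrt Q + (N : ℝ) ^ (4 / 5 : ℝ) + (N : ℝ) / Real.sqrt P) *
            Real.log N ^ 4 := by
  obtain ⟨C, hC0, hC⟩ := norm_primeSum_vinogradov
  refine ⟨C, hC0, fun N hN P Q hP hPN hQ α hα => ?_⟩
  have hN0 : (0 : ℝ) < N := by exact_mod_cast (show 0 < N by omega)
  obtain ⟨hαI, hαM⟩ := hα
  -- Dirichlet
  set n₀ : ℕ := ⌊(N : ℝ) / P⌋₊ with hn₀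
  have hn₀pos : 0 < n₀ := Nat.floor_pos.2 (by rw [le_div_iff₀ (by linarith)]; linarith)
  obtain ⟨r, hr, hrden⟩ := Real.exists_rat_abs_sub_le_and_den_le α hn₀pos
  set q : ℕ := r.den with hq
  set a : ℤ := r.num with ha
  have hq1 : 1 ≤ q := r.den_pos
  have hq0 : (0 : ℝ) < q := by exact_mod_cast r.den_pos
  have hrq : (r : ℝ) = a / q := by rw [ha, hq]; exact_mod_cast r.num_div_den.symm
  have hcop : IsCoprime a (q : ℤ) := by
    rw [Int.isCoprime_iff_gcd_eq_one, ha, hq]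
    exact r.reduced
  have hn₀le : (n₀ : ℝ) ≤ N / P := Nat.floor_le (by positivity)
  have hn₀lt : (N : ℝ) / P < n₀ + 1 := Nat.lt_floor_add_one _
  have hqn₀ : (q : ℝ) ≤ n₀ := by exact_mod_cast hrden
  have hqNP : (q : ℝ) ≤ N / P := hqn₀.trans hn₀le
  have hqN : q ≤ N := by
    have : (q : ℝ) ≤ N := hqNP.trans (div_le_self hN0.le hP)
    exact_mod_cast this
  have hαq : |α - a / q| ≤ 1 / ((n₀ + 1) * q) := by rw [← hrq]; exact hr
  have hαq2 : |α - a / q| ≤ 1 / (q : ℝ) ^ 2 := by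
    refine hαq.trans ?_
    rw [sq]
    exact one_div_le_one_div_of_le (by positivity)
      (mul_le_mul_of_nonneg_right (by linarith) hq0.le)
  -- `q > Q`, for otherwise `α` would lie on a major arc
  have hqQ : ⌊Q⌋₊ < q := by
    by_contra hle
    push Not at hle
    apply hαM
    have hsmall : (1 : ℝ) / ((n₀ + 1) * q) < 1 / q := by
      apply one_div_lt_one_div_of_lt hq0
      have : (1 : ℝ) ≤ n₀ := by exact_mod_cast hn₀pos
      nlinarith
    have hαq' := abs_le.1 hαq
    have ha0 : 0 ≤ a := by
      have h3 : (-1 : ℝ) / q < a / q := by rw [neg_div]; linarith [hαI.1]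
      have h4 : (-1 : ℝ) < a := by linarith [(div_lt_div_iff_of_pos_right hq0).1 h3]
      exact_mod_cast (show (-1 : ℤ) < a by exact_mod_cast h4)
    have haq : a ≤ q := by
      have h3 : (a : ℝ) / q < (q + 1) / q := by
        rw [add_div, div_self hq0.ne']; linarith [hαI.2]
      have h4 : (a : ℝ) < q + 1 := by linarith [(div_lt_div_iff_of_pos_right hq0).1 h3]
      have h5 : a < (q : ℤ) + 1 := by exact_mod_cast h4
      omega
    unfold majorArcs
    simp only [Set.mem_iUnion, exists_prop]
    have hnat : (a.natAbs : ℤ) = a := Int.natAbs_of_nonneg ha0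
    refine ⟨q, mem_Icc.2 ⟨hq1, hle⟩, a.natAbs, ?_, ?_⟩
    · rw [mem_filter, mem_range]
      refine ⟨by omega, ?_⟩
      simpa using Int.isCoprime_iff_nat_coprime.1 hcop
    · refine ⟨hαI, ?_⟩
      have : ((a.natAbs : ℤ) : ℝ) = a := by rw [hnat]
      rw [this]
      refine hαq.trans ?_
      calc (1 : ℝ) / ((n₀ + 1) * q) ≤ 1 / (n₀ + 1) := by
            apply one_div_le_one_div_of_le (by positivity)
            have : (1 : ℝ) ≤ q := by exact_mod_cast hq1
            nlinarith
        _ ≤ P / N := by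
            rw [div_le_div_iff₀ (by positivity) hN0, one_mul]
            rw [div_lt_iff₀ (by linarith)] at hn₀lt
            linarith
  -- apply Vinogradov
  have hV := hC N hN α a q hq1 hqN hcop hαq2
  refine hV.trans (mul_le_mul_of_nonneg_right (mul_le_mul_of_nonneg_left ?_ hC0)
    (pow_nonneg (Real.log_nonneg (by exact_mod_cast (show 1 ≤ N by omega))) 4))
  have hQq : Q < q := (Nat.lt_of_floor_lt hqQ)
  have h1 : (N : ℝ) / Real.sqrt q ≤ N / Real.sqrt Q :=
    div_le_div_of_nonneg_left hN0.le (Real.sqrt_pos.2 (by linarith)) (Real.sqrt_le_sqrt hQq.le)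
  have h2 : Real.sqrt N * Real.sqrt q ≤ N / Real.sqrt P := by
    rw [le_div_iff₀ (Real.sqrt_pos.2 (by linarith))]
    calc Real.sqrt N * Real.sqrt q * Real.sqrt P = Real.sqrt N * Real.sqrt (q * P) := by
          rw [Real.sqrt_mul hq0.le, mul_assoc]
      _ ≤ Real.sqrt N * Real.sqrt N := by
          refine mul_le_mul_of_nonneg_left (Real.sqrt_le_sqrt ?_) (Real.sqrt_nonneg _)
          rw [le_div_iff₀ (by linarith)] at hqNP
          exact hqNP
      _ = N := Real.mul_self_sqrt hN0.le
  linarith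

/-! ### Pintz–Ruzsa's arcs (2.2)–(2.3): `q`-dependent width `1/(qQ)` -/

/-- `S(α + 1) = S(α)`: `S` has period `1`. [folklore] -/
theorem primeSum_add_one (N : ℕ) (α : ℝ) : primeSum N (α + 1) = primeSum N α := by
  unfold primeSum
  refine Finset.sum_congr rfl fun p _ => ?_
  have h1 : (𝐞 ((p : ℕ) : ℝ) : ℂ) = 1 := by
    rw [← Int.cast_natCast (R := ℝ) p, Real.fourierChar_apply', Circle.exp_two_pi_mul_int,
      Circle.coe_one]
  rw [mul_add, mul_one, fourierChar_add_coe, h1, mul_one]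

/-- `G(α + 1) = G(α)`: `G` has period `1`. [folklore] -/
theorem powSum_add_one (N : ℕ) (α : ℝ) : powSum N (α + 1) = powSum N α := by
  unfold powSum
  refine Finset.sum_congr rfl fun m _ => ?_
  have h1 : (𝐞 (((2 ^ m : ℕ) : ℕ) : ℝ) : ℂ) = 1 := by
    rw [← Int.cast_natCast (R := ℝ) (2 ^ m), Real.fourierChar_apply', Circle.exp_two_pi_mul_int,
      Circle.coe_one]
  rw [mul_add, mul_one, fourierChar_add_coe, h1, mul_one]

/-- **Minor-arc bound for `S(α)` on Pintz–Ruzsa's arcs** ((2.2)–(2.3), (2.9)–(2.10), unconditional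
form via Vinogradov): for `N ≥ 3`, `1 ≤ P`, `P + 1 ≤ Q ≤ N` and `α ∈ [1/Q, 1 + 1/Q]` off
`𝔐 = ⋃_{q ≤ P} ⋃_{(a,q)=1} [a/q - 1/(qQ), a/q + 1/(qQ)]` (the tree's `MontgomeryVaughan1975.minorArcs P Q`),
Dirichlet's theorem gives `(a, q) = 1`, `P < q ≤ Q`, `|α - a/q| < 1/(qQ) ≤ q⁻²`, and Vinogradov's
estimate yields `|S(α)| ≤ C (N/√P + N^{4/5} + √N √Q) log⁴ N`.
[cite: PintzRuzsa2003, Lemma 2 (2.9)–(2.10) and (2.2)–(2.3)] -/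
theorem norm_primeSum_le_of_mem_minorArcsMV :
    ∃ C : ℝ, 0 ≤ C ∧ ∀ N : ℕ, 3 ≤ N → ∀ P Q : ℝ, 1 ≤ P → P + 1 ≤ Q → Q ≤ N →
      ∀ α ∈ MontgomeryVaughan1975.minorArcs P Q,
        ‖primeSum N α‖ ≤
          C * ((N : ℝ) / Real.sqrt P + (N : ℝ) ^ (4 / 5 : ℝ) + Real.sqrt N * Real.sqrt Q) *
            Real.log N ^ 4 := by
  obtain ⟨C, hC0, hC⟩ := norm_primeSum_vinogradov
  refine ⟨C, hC0, fun N hN P Q hP hPQ hQN α hα => ?_⟩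
  obtain ⟨a, q, hq1, hPq, hqQ, hcop, hαq⟩ :=
    MontgomeryVaughan1975.exists_rat_of_mem_minorArcs hP hPQ hα
  have hN0 : (0 : ℝ) < N := by exact_mod_cast (show 0 < N by omega)
  have hq0 : (0 : ℝ) < q := by exact_mod_cast hq1
  have hqN : q ≤ N := by
    have : (q : ℝ) ≤ N := hqQ.trans hQN
    exact_mod_cast this
  have hαq2 : |α - a / q| ≤ 1 / (q : ℝ) ^ 2 := by
    refine hαq.le.trans ?_
    rw [sq]
    exact one_div_le_one_div_of_le (by positivity) (mul_le_mul_of_nonneg_left hqQ hq0.le)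
  have hV := hC N hN α a q hq1 hqN hcop hαq2
  refine hV.trans (mul_le_mul_of_nonneg_right (mul_le_mul_of_nonneg_left ?_ hC0)
    (pow_nonneg (Real.log_nonneg (by exact_mod_cast (show 1 ≤ N by omega))) 4))
  have h1 : (N : ℝ) / Real.sqrt q ≤ N / Real.sqrt P :=
    div_le_div_of_nonneg_left hN0.le (Real.sqrt_pos.2 (by linarith)) (Real.sqrt_le_sqrt hPq.le)
  have h2 : Real.sqrt N * Real.sqrt q ≤ Real.sqrt N * Real.sqrt Q :=
    mul_le_mul_of_nonneg_left (Real.sqrt_le_sqrt hqQ) (Real.sqrt_nonneg _)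
  linarith

/-- The periodised arcs `𝔐 ∪ (𝔐 - 1)` (the part of Pintz–Ruzsa's `𝔐 ⊆ [1/Q, 1 + 1/Q]` lying in
`[1, 1 + 1/Q]`, translated back into `[0, 1/Q]`) are measurable. [folklore] -/
theorem measurableSet_periodic_majorArcs (P Q : ℝ) :
    MeasurableSet (MontgomeryVaughan1975.majorArcs P Q ∪
      (fun α : ℝ => α + 1) ⁻¹' MontgomeryVaughan1975.majorArcs P Q) :=
  (MontgomeryVaughan1975.measurableSet_majorArcs P Q).union
    ((measurable_id.add_const 1) (MontgomeryVaughan1975.measurableSet_majorArcs P Q))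

/-- **Minor-arc bound on `[0,1]`** for the periodised Pintz–Ruzsa arcs: for `N ≥ 3`, `1 ≤ P`,
`P + 1 ≤ Q ≤ N` and `α ∈ [0,1]` with neither `α` nor `α + 1` on
`𝔐 = ⋃_{q ≤ P} ⋃_{(a,q)=1} [a/q - 1/(qQ), a/q + 1/(qQ)]`,
`|S(α)| ≤ C (N/√P + N^{4/5} + √N √Q) log⁴ N` (by `1`-periodicity of `S`: `α` or `α + 1` lies in
`[1/Q, 1 + 1/Q] ∖ 𝔐`). This is the input `hS` of `goldbach_linnik_of_analytic_inputs` for the arcs of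
Pintz–Ruzsa I (2.3) / Part II. [cite: PintzRuzsa2003, Lemma 2 (2.9)–(2.10) and (2.2)–(2.3)] -/
theorem norm_primeSum_le_of_not_mem_periodic_majorArcs :
    ∃ C : ℝ, 0 ≤ C ∧ ∀ N : ℕ, 3 ≤ N → ∀ P Q : ℝ, 1 ≤ P → P + 1 ≤ Q → Q ≤ N →
      ∀ α ∈ Set.Icc (0 : ℝ) 1 \ (MontgomeryVaughan1975.majorArcs P Q ∪
          (fun α : ℝ => α + 1) ⁻¹' MontgomeryVaughan1975.majorArcs P Q),
        ‖primeSum N α‖ ≤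
          C * ((N : ℝ) / Real.sqrt P + (N : ℝ) ^ (4 / 5 : ℝ) + Real.sqrt N * Real.sqrt Q) *
            Real.log N ^ 4 := by
  obtain ⟨C, hC0, hC⟩ := norm_primeSum_le_of_mem_minorArcsMV
  refine ⟨C, hC0, fun N hN P Q hP hPQ hQN α hα => ?_⟩
  obtain ⟨⟨hα0, hα1⟩, hαM⟩ := hα
  simp only [Set.mem_union, Set.mem_preimage, not_or] at hαM
  have hQ0 : 0 < Q := by linarith
  have hQinv1 : Q⁻¹ ≤ 1 := inv_le_one_of_one_le₀ (by linarith)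
  by_cases hαQ : Q⁻¹ ≤ α
  · -- `α ∈ [1/Q, 1 + 1/Q] ∖ 𝔐`
    refine hC N hN P Q hP hPQ hQN α ⟨⟨hαQ, ?_⟩, hαM.1⟩
    linarith [inv_pos.2 hQ0]
  · -- `α + 1 ∈ [1/Q, 1 + 1/Q] ∖ 𝔐`
    push Not at hαQ
    have h := hC N hN P Q hP hPQ hQN (α + 1) ⟨⟨by linarith, by linarith⟩, hαM.2⟩
    rwa [primeSum_add_one] at h

end GoldbachLinnik

end Literature.NumberTheory.Sieve
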